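import Summits.ResolutionOfSingularities.ResolutionOfSingularities.Theorems.HilbertSamuelEliminationSigmaMaxModificationsCorridor3WLadderHybridLowReplayDefs
import HarnessLib

/-!
# [OURS · L1 W4.2] `Corridor3WLadderHybridLowReplay` — THE (c-rep) SUPPLIER for the menu hybrid `π.hybrid (ofStageOracleE ω)`: late blow-ups of the
# chain point lead to a state between cycles, FROM (c-reg)From, for a fallback oracle naming centres over the NON-REGULAR locus of the treated part
# and a policy emitting `P′ = none` — port of res-L1-w42-stub-4's replay-square argument `strataReplayBlowupsSettle_of_cycleStartRegular`

Crux chain w42 (`SigmaMaxModifications`, stmt-ResolutionOfSingularities-18506; conjunct `SigmaMaxModificationsCorridor3`,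
stmt-ResolutionOfSingularities-19249), CHAIN v3.20 §0s.4 «040: HybridLow follow-ups ((c-rep)/(c-menu) suppliers)»; memo `LOW-SUPPLIERS-memo.md`
(47a2e00fad984739) §2 (c-rep) with design clauses (D-ii) «ω names sequences whose centres lie over the non-regular locus of the part» and (D-iii) = (β)
«policy steps emit `P′ = none`» — both HYPOTHESES here (`hωsing`, `hπnone`), to be met by the CHOICE of (π, ω) in `HybridEliminationHyp3S` (∃-form).
Typer res-type-040 (gen 19). Over `…WLadderHybridLowReplayDefs` (row `StrataCycleStartRegularFromσE`), `…WLadderHybridLowSwallow` (p535770: row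
`StrataReplaySettleFromσE`), stub-4's `…WLadderStrataReplay` (`treatedPartIdeal`, `isLeast_treatedLabel_of_none`, `base_preimage_comp`, `chainComp`).
OURS (cell res-hironaka, slot W4.2); NOT statements of H. Hironaka's manuscript [Hironaka2017] nor of [CossartJannsenSaito2020]; AI-drafted, weaker
than expert review. Sorry-free PROOF file: no definition, no named fact. Helper file `--supports stmt-ResolutionOfSingularities-19249` (counted 0).

THE ARGUMENT (stub-4's, read for the hybrid). A step of the hybrid that leads INTO a cycle (`P′ = some _`) is a FALLBACK step (policy steps emit
`none`): a cycle START (ω names `t` on the reduced treated part `S_r = (Y_r^{(j)})_red`, `j` the least non-empty label; by `hωsing` the centres of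
`t` lie over `(Reg S_r)ᶜ`) or a REPLAY step (the replay square `φ' ≫ π_C = π_D ≫ φ` carries «the centres still to be replayed lie over the preimage
of `ι_r((Reg S_r)ᶜ)` under replayed immersion + blow-downs to stage `r`»). So a late blow-up of `x_m` whose next state is inside a cycle has a
centre over `ι_r((Reg S_r)ᶜ)` and the blow-downs map `x_m ↦ x_r`: `x_r` is a non-regular point of `S_r` — against (c-reg)From. Policy steps may
ABORT cycles (their `none` restarts the bookkeeping); nothing else changes.

Contents (namespace `…Theorems.SigmaMaxModificationsCorridor3.Sigma`): §1 one-step replay bookkeeping for hybrid step projections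
(`centresOver_of_none_hybrid`, `centresOver_of_some_hybrid`, `support_subset_image_of_some_hybrid`, `support_subset_image_of_none_hybrid`,
`isCanonicalStepΩE_of_hybrid_of_ne_none`); §2 `chainComp_base_pt_σE`, `exists_next_none_hybrid` (cycles end or are aborted within `|rest| + 1`
steps); §3 **`strataReplaySettleFromσE_hybrid_of_cycleStartRegular`** ((c-rep)From ⟸ (c-reg)From) and the Low class from (b)/(c-reg)/(c-menu)/units
(`low_init_hybrid_of_rows_cycleStartRegular`). References: CJS LNM 2270 Rem. 6.29 (1) pp. 91–92, p. 102 [CossartJannsenSaito2020]; Görtz–Wedhorn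
I Prop. 13.91 (1), 13.96 (2) [GortzWedhorn2020]; tree `…WLadderStrataReplay` (stub-4), p535770, p534481.
-/

noncomputable section

set_option linter.dupNamespace false

open CategoryTheory AlgebraicGeometry TopologicalSpace Topology
open Summit.ResolutionOfSingularities.ResolutionOfSingularities.Theorems.CampaignW42
open Literature.AlgebraicGeometry.Resolution Literature.RingTheory.HilbertSamuel
open Literature.AlgebraicGeometry.CossartJannsenSaito2020
open Summit.ResolutionOfSingularities.ResolutionOfSingularities.Theorems.SigmaMaxModificationsCorridor3
open Summit.ResolutionOfSingularities.ResolutionOfSingularities.Theorems.SigmaMaxModificationsCorridor3.Moving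

namespace Summit.ResolutionOfSingularities.ResolutionOfSingularities.Theorems.SigmaMaxModificationsCorridor3.Sigma

universe u

variable {π : StrategyE.{u}} {ω : StageOracleE.{u}} {N : ℕ} {ν : ℕ → ℕ}

/-! ## §1. One-step replay bookkeeping along a hybrid step projection -/

section OneStep

variable {s s' : MarkedStageE.{u}} {f : s'.W ⟶ s.W}

/-- **A hybrid step leading INTO a cycle is a fallback step** (policy steps emit `none`). [folklore] -/
theorem isCanonicalStepΩE_of_hybrid_of_ne_none
    (hπnone : ∀ (W : Scheme.{u}) (hW : IsLocallyNoetherian W) (L : Labelling W) (P : Option (Pending W)) (E : Boundary W)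
      (C : W.IdealSheafData) (P' : Option (Pending (blowup C))), π.step W hW N ν L P E C P' → P' = none)
    {C : s.W.IdealSheafData} {P' : Option (Pending (blowup C))} (hP' : P' ≠ none)
    (hcs : (π.hybrid (StrategyE.ofStageOracleE ω)).step s.W s.ln N ν s.L s.P s.E C P') :
    IsCanonicalStepΩE ω s.ln N ν s.L s.E s.P C P' := by
  rcases StrategyE.hybrid_step_cases hcs with hπs | hτs
  · exact absurd (hπnone _ _ _ _ _ _ _ hπs) hP'
  · exact hτs

/-- **A cycle START whose next state is inside a cycle: the centres still to be replayed lie over the non-regular locus of the treated part**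
(ω names centres over the non-regular locus), read through the replayed immersion followed by the blow-down `f` (E/hybrid copy of stub-4's
`StepProjection.centresOver_of_none`). [cite: CossartJannsenSaito2020, Rem. 6.29 (1), p. 102] -/
theorem centresOver_of_none_hybrid
    (hπnone : ∀ (W : Scheme.{u}) (hW : IsLocallyNoetherian W) (L : Labelling W) (P : Option (Pending W)) (E : Boundary W)
      (C : W.IdealSheafData) (P' : Option (Pending (blowup C))), π.step W hW N ν L P E C P' → P' = none)
    (hωsing : ∀ (W : Scheme.{u}) (hW : IsLocallyNoetherian W) (N : ℕ) (ν : ℕ → ℕ) (L : Labelling W) (E : Boundary W) (S : Scheme.{u})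
      (φ : S ⟶ W) (t : CentreSeq S), ω.namesE W hW N ν L E S φ t → t.CentresOver (Scheme.regularLocus S)ᶜ)
    (hf : StepProjectionσE (π.hybrid (StrategyE.ofStageOracleE ω)) N ν s s' f) (hP : s.P = none) {j : ℕ}
    (hj : IsLeast {i | (s.L.part (Scheme.hsStratum s.W N ν) i).Nonempty} j)
    (hcl : IsClosed (s.L.part (Scheme.hsStratum s.W N ν) j)) {Q' : Pending s'.W} (hQ' : s'.P = some Q') :
    Q'.rest.CentresOver ((Q'.hom ≫ f).base ⁻¹'
      ((treatedPartIdeal N ν s.toMarkedStage j hcl).subschemeι.base ''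
        (Scheme.regularLocus (treatedPartIdeal N ν s.toMarkedStage j hcl).subscheme)ᶜ)) := by
  obtain ⟨C, P', hln, x', hcs, -, -, -, e, rfl⟩ := hf
  subst e
  change P' = some Q' at hQ'
  have hτ := isCanonicalStepΩE_of_hybrid_of_ne_none hπnone (by rw [hQ']; exact Option.some_ne_none Q') hcs
  rw [hP] at hτ
  obtain ⟨j₀, hj₀, hcl₀, t, hRt, hrep⟩ := hτ
  have hjj : j = j₀ := hj.unique hj₀
  subst hjj
  have hover := hωsing _ _ _ _ _ _ _ _ _ hRt
  cases t with
  | nil _ =>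
    obtain ⟨-, hnone⟩ := hrep
    rw [hnone] at hQ'
    exact absurd hQ' (by simp)
  | cons D rest =>
    obtain ⟨-, φ', hφ', hsq, hsome⟩ := hrep
    rw [hsome] at hQ'
    cases hQ'
    obtain ⟨-, hrest⟩ := hover
    simp only [eqToHom_refl, Category.id_comp]
    rw [base_preimage_comp, ← base_preimage_comp, hsq, base_preimage_comp]
    show rest.CentresOver ((blowup.π D).base ⁻¹' ((treatedPartIdeal N ν s.toMarkedStage j hcl).subschemeι.base ⁻¹'
      ((treatedPartIdeal N ν s.toMarkedStage j hcl).subschemeι.base ''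
        (Scheme.regularLocus (treatedPartIdeal N ν s.toMarkedStage j hcl).subscheme)ᶜ)))
    rw [(treatedPartIdeal N ν s.toMarkedStage j hcl).subschemeι.isClosedEmbedding.injective.preimage_image]
    exact hrest

/-- **Inside a cycle the replay invariant propagates along a hybrid step leading into a cycle** (E/hybrid copy of stub-4's
`StepProjection.centresOver_of_some`). [cite: CossartJannsenSaito2020, Rem. 6.29 (1)] [cite: GortzWedhorn2020, Prop. 13.91 (1)] -/
theorem centresOver_of_some_hybrid
    (hπnone : ∀ (W : Scheme.{u}) (hW : IsLocallyNoetherian W) (L : Labelling W) (P : Option (Pending W)) (E : Boundary W)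
      (C : W.IdealSheafData) (P' : Option (Pending (blowup C))), π.step W hW N ν L P E C P' → P' = none)
    (hf : StepProjectionσE (π.hybrid (StrategyE.ofStageOracleE ω)) N ν s s' f) {Q : Pending s.W} (hP : s.P = some Q) {B : Scheme.{u}}
    (g : s.W ⟶ B) (T : Set B) (hco : Q.rest.CentresOver ((Q.hom ≫ g).base ⁻¹' T)) {Q' : Pending s'.W} (hQ' : s'.P = some Q') :
    Q'.rest.CentresOver ((Q'.hom ≫ f ≫ g).base ⁻¹' T) := by
  obtain ⟨C, P', hln, x', hcs, -, -, -, e, rfl⟩ := hf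
  subst e
  change P' = some Q' at hQ'
  have hτ := isCanonicalStepΩE_of_hybrid_of_ne_none hπnone (by rw [hQ']; exact Option.some_ne_none Q') hcs
  rw [hP] at hτ
  obtain ⟨-, hrep⟩ := hτ
  haveI := Q.isClosedImmersion
  generalize hr : Q.rest = r at hrep hco
  cases r with
  | nil _ =>
    obtain ⟨-, hnone⟩ := hrep
    rw [hnone] at hQ'
    exact absurd hQ' (by simp)
  | cons D t =>
    obtain ⟨-, φ', hφ', hsq, hsome⟩ := hrep
    rw [hsome] at hQ'
    cases hQ'
    obtain ⟨-, ht⟩ := hco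
    simp only [eqToHom_refl, Category.id_comp]
    rw [← Category.assoc, base_preimage_comp, hsq, base_preimage_comp]
    rw [base_preimage_comp] at ht
    exact ht

/-- **The centre of a hybrid step INSIDE a cycle whose next state is still inside the cycle lies over the replay invariant's set** (π, ω functional:
the allowed step is THE chain's step). (E/hybrid copy of stub-4's `StepProjection.support_subset_image_of_some`.) [cite: CossartJannsenSaito2020, Rem. 6.29 (1)] -/
theorem support_subset_image_of_some_hybrid (hfun : (π.hybrid (StrategyE.ofStageOracleE ω)).IsFunctional N ν)
    (hπnone : ∀ (W : Scheme.{u}) (hW : IsLocallyNoetherian W) (L : Labelling W) (P : Option (Pending W)) (E : Boundary W)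
      (C : W.IdealSheafData) (P' : Option (Pending (blowup C))), π.step W hW N ν L P E C P' → P' = none)
    (hf : StepProjectionσE (π.hybrid (StrategyE.ofStageOracleE ω)) N ν s s' f) {Q : Pending s.W} (hP : s.P = some Q)
    (hs' : s'.P ≠ none) {S₀ : Set Q.src} (hco : Q.rest.CentresOver S₀) {C : s.W.IdealSheafData} {P' : Option (Pending (blowup C))}
    (hcs : (π.hybrid (StrategyE.ofStageOracleE ω)).step s.W s.ln N ν s.L s.P s.E C P') :
    (C.support : Set s.W) ⊆ Q.hom.base '' S₀ := by
  obtain ⟨C₀, P₀, hln, x', hcs₀, -, -, -, e, rfl⟩ := hf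
  subst e
  change P₀ ≠ none at hs'
  obtain rfl : C = C₀ := (hfun s.W s.ln s.L s.P s.E).1 C C₀ P' P₀ hcs hcs₀
  have hτ := isCanonicalStepΩE_of_hybrid_of_ne_none hπnone hs' hcs₀
  rw [hP] at hτ
  obtain ⟨-, hrep⟩ := hτ
  haveI := Q.isClosedImmersion
  generalize hr : Q.rest = r at hrep hco
  cases r with
  | nil _ =>
    obtain ⟨-, hnone⟩ := hrep
    exact absurd hnone hs'
  | cons D t =>
    have hsupp : (C.support : Set s.W) = closure (Q.hom.base '' (D.support : Set Q.src)) := hrep.support_eq_closure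
    obtain ⟨hD, -⟩ := hco
    rw [hsupp, (Q.hom.isClosedEmbedding.isClosedMap _ D.support.isClosed).closure_eq]
    exact Set.image_mono hD

/-- **The centre of a hybrid cycle START whose next state is inside the cycle lies over the non-regular locus of the treated part** (π, ω
functional; ω names centres over the non-regular locus). (E/hybrid copy of stub-4's `StepProjection.support_subset_image_of_none`.)
[cite: CossartJannsenSaito2020, Rem. 6.29 (1), p. 102] -/
theorem support_subset_image_of_none_hybrid (hfun : (π.hybrid (StrategyE.ofStageOracleE ω)).IsFunctional N ν)
    (hπnone : ∀ (W : Scheme.{u}) (hW : IsLocallyNoetherian W) (L : Labelling W) (P : Option (Pending W)) (E : Boundary W)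
      (C : W.IdealSheafData) (P' : Option (Pending (blowup C))), π.step W hW N ν L P E C P' → P' = none)
    (hωsing : ∀ (W : Scheme.{u}) (hW : IsLocallyNoetherian W) (N : ℕ) (ν : ℕ → ℕ) (L : Labelling W) (E : Boundary W) (S : Scheme.{u})
      (φ : S ⟶ W) (t : CentreSeq S), ω.namesE W hW N ν L E S φ t → t.CentresOver (Scheme.regularLocus S)ᶜ)
    (hf : StepProjectionσE (π.hybrid (StrategyE.ofStageOracleE ω)) N ν s s' f) (hP : s.P = none) {j : ℕ}
    (hj : IsLeast {i | (s.L.part (Scheme.hsStratum s.W N ν) i).Nonempty} j)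
    (hcl : IsClosed (s.L.part (Scheme.hsStratum s.W N ν) j)) (hs' : s'.P ≠ none) {C : s.W.IdealSheafData}
    {P' : Option (Pending (blowup C))} (hcs : (π.hybrid (StrategyE.ofStageOracleE ω)).step s.W s.ln N ν s.L s.P s.E C P') :
    (C.support : Set s.W) ⊆ (treatedPartIdeal N ν s.toMarkedStage j hcl).subschemeι.base ''
      (Scheme.regularLocus (treatedPartIdeal N ν s.toMarkedStage j hcl).subscheme)ᶜ := by
  obtain ⟨C₀, P₀, hln, x', hcs₀, -, -, -, e, rfl⟩ := hf
  subst e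
  change P₀ ≠ none at hs'
  obtain rfl : C = C₀ := (hfun s.W s.ln s.L s.P s.E).1 C C₀ P' P₀ hcs hcs₀
  have hτ := isCanonicalStepΩE_of_hybrid_of_ne_none hπnone hs' hcs₀
  rw [hP] at hτ
  obtain ⟨j₀, hj₀, hcl₀, t, hRt, hrep⟩ := hτ
  have hjj : j = j₀ := hj.unique hj₀
  subst hjj
  have hover := hωsing _ _ _ _ _ _ _ _ _ hRt
  cases t with
  | nil _ =>
    obtain ⟨-, hnone⟩ := hrep
    exact absurd hnone hs'
  | cons D rest =>
    have hsupp := hrep.support_eq_closure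
    obtain ⟨hD, -⟩ := hover
    rw [hsupp, ((Scheme.IdealSheafData.vanishingIdeal ⟨s.L.part (Scheme.hsStratum s.W N ν) j, hcl₀⟩).subschemeι
      |>.isClosedEmbedding.isClosedMap _ D.support.isClosed).closure_eq]
    exact Set.image_mono hD

end OneStep

/-! ## §2. Blow-downs composed along a hybrid chain; cycles end or are aborted -/

/-- **The composed blow-downs map the chain point to the chain point** (σE step projections). [folklore] -/
theorem chainComp_base_pt_σE {σ : StrategyE.{u}} {c : ℕ → MarkedStageE.{u}} {f : ∀ n, (c (n + 1)).W ⟶ (c n).W}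
    (hf : ∀ n, StepProjectionσE σ N ν (c n) (c (n + 1)) (f n)) (r : ℕ) :
    ∀ d, (chainComp (fun n => (c n).toMarkedStage) f r d).base (c (r + d)).pt = (c r).pt
  | 0 => rfl
  | d + 1 => by
    rw [chainComp_succ, Scheme.Hom.comp_apply]
    have h1 : (f (r + d)) (c (r + (d + 1))).pt = (c (r + d)).pt := (hf (r + d)).base_pt
    rw [h1]
    exact chainComp_base_pt_σE hf r d

/-- **Along a hybrid chain a state between cycles recurs**: from any stage `n` there is `m ≥ n` with `(c m).P = none` (a fallback replay shortens the
pending list, a fallback END and every policy step emit `none`). [cite: CossartJannsenSaito2020, Rem. 6.29 (1)] -/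
theorem exists_next_none_hybrid
    (hπnone : ∀ (W : Scheme.{u}) (hW : IsLocallyNoetherian W) (L : Labelling W) (P : Option (Pending W)) (E : Boundary W)
      (C : W.IdealSheafData) (P' : Option (Pending (blowup C))), π.step W hW N ν L P E C P' → P' = none)
    {c : ℕ → MarkedStageE.{u}} (hstep : ∀ n, CanonicalNearStepσE (π.hybrid (StrategyE.ofStageOracleE ω)) N ν (c n) (c (n + 1)))
    (n : ℕ) : ∃ m, n ≤ m ∧ (c m).P = none := by
  -- the length of the pending list, `0` between cycles
  let len : MarkedStageE.{u} → ℕ := fun s => s.P.elim 0 fun Q => Q.rest.length + 1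
  have hdrop : ∀ k, (c k).P ≠ none → len (c (k + 1)) < len (c k) := by
    intro k hk
    obtain ⟨Q, hQ⟩ := Option.ne_none_iff_exists'.mp hk
    obtain ⟨C, P', hln, x', hcs, -, -, -, hc⟩ := hstep k
    have hlen' : len (c (k + 1)) = P'.elim 0 fun Q' => Q'.rest.length + 1 := by rw [hc]
    have hlen : len (c k) = Q.rest.length + 1 := by simp [len, hQ]
    rw [hlen', hlen]
    rcases StrategyE.hybrid_step_cases hcs with hπs | hτs
    · rw [hπnone _ _ _ _ _ _ _ hπs]
      exact Nat.succ_pos _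
    · change IsCanonicalStepΩE ω (c k).ln N ν (c k).L (c k).E (c k).P C P' at hτs
      rw [hQ] at hτs
      obtain ⟨-, hrep⟩ := hτs
      generalize hr : Q.rest = r at hrep
      cases r with
      | nil _ =>
        obtain ⟨-, hnone⟩ := hrep
        rw [hnone]
        exact Nat.succ_pos _
      | cons D t =>
        obtain ⟨-, φ', hφ', -, hsome⟩ := hrep
        rw [hsome]
        simp [CentreSeq.length]
  -- descend on `len`
  have key : ∀ L k, len (c k) ≤ L → ∃ m, k ≤ m ∧ (c m).P = none := by
    intro L
    induction L with
    | zero =>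
      intro k hk
      refine ⟨k, le_rfl, ?_⟩
      rcases hP : (c k).P with _ | Q
      · rfl
      · simp [len, hP] at hk
    | succ L ih =>
      intro k hk
      rcases hP : (c k).P with _ | Q
      · exact ⟨k, le_rfl, hP⟩
      · have hlt := hdrop k (by rw [hP]; simp)
        obtain ⟨m, hkm, hm⟩ := ih (k + 1) (by omega)
        exact ⟨m, by omega, hm⟩
  exact key _ n le_rfl

/-! ## §3. (c-rep)From for the hybrid from (c-reg)From -/

/-- **THE (c-rep) SUPPLIER — PROVED: `StrataReplaySettleFromσE (π.hybrid (ofStageOracleE ω)) N ν s₀ G` FROM `StrataCycleStartRegularFromσE`**, for π,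
ω functional, π emitting `none` ((β)), ω naming centres over the non-regular locus of the part ((D-ii)), on the scope «every state reached from `s₀`
is RunGood» (closed parts), `s₀.pt ∈ X(ν)` (non-empty strata). Port of stub-4's `strataReplayBlowupsSettle_of_cycleStartRegular`.
[cite: CossartJannsenSaito2020, Rem. 6.29 (1), p. 102] -/
theorem strataReplaySettleFromσE_hybrid_of_cycleStartRegular {k : Type u} [Field k] {s₀ : MarkedStageE.{u}} {G : MarkedStage.{u} → Prop}
    (hπ : π.IsFunctional N ν) (hω : OracleFunctionalΩE ω)
    (hπnone : ∀ (W : Scheme.{u}) (hW : IsLocallyNoetherian W) (L : Labelling W) (P : Option (Pending W)) (E : Boundary W)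
      (C : W.IdealSheafData) (P' : Option (Pending (blowup C))), π.step W hW N ν L P E C P' → P' = none)
    (hωsing : ∀ (W : Scheme.{u}) (hW : IsLocallyNoetherian W) (N : ℕ) (ν : ℕ → ℕ) (L : Labelling W) (E : Boundary W) (S : Scheme.{u})
      (φ : S ⟶ W) (t : CentreSeq S), ω.namesE W hW N ν L E S φ t → t.CentresOver (Scheme.regularLocus S)ᶜ)
    (hgood : ∀ s, ReachesσE (π.hybrid (StrategyE.ofStageOracleE ω)) N ν s₀ s → RunGood k N ν s.W)
    (hpt₀ : s₀.pt ∈ Scheme.hsStratum s₀.W N ν)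
    (hreg : StrataCycleStartRegularFromσE (π.hybrid (StrategyE.ofStageOracleE ω)) N ν s₀ G) :
    StrataReplaySettleFromσE (π.hybrid (StrategyE.ofStageOracleE ω)) N ν s₀ G := by
  have hfun : (π.hybrid (StrategyE.ofStageOracleE ω)).IsFunctional N ν := hπ.hybrid (StrategyE.isFunctional_ofStageOracleE hω N ν)
  intro c h0 hstep hG hnI hmov
  obtain ⟨n₁, hn₁⟩ := hreg c h0 hstep hG hnI hmov
  have hreach : ∀ n, ReachesσE (π.hybrid (StrategyE.ofStageOracleE ω)) N ν s₀ (c n) := reachesσE_chain h0 hstep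
  have hproj : ∀ n, ∃ f : (c (n + 1)).W ⟶ (c n).W, StepProjectionσE (π.hybrid (StrategyE.ofStageOracleE ω)) N ν (c n) (c (n + 1)) f :=
    fun n => (hstep n).exists_stepProjectionσE
  choose f hf using hproj
  have hne : ∀ n, (Scheme.hsStratum (c n).W N ν).Nonempty := fun n =>
    ⟨_, pt_mem_hsStratum_of_reachesσE (hreach n) hpt₀⟩
  have hclP : ∀ n i, IsClosed ((c n).L.part (Scheme.hsStratum (c n).W N ν) i) := fun n i => by
    haveI : IsNoetherian (c n).W := by
      obtain ⟨g, hg, hq⟩ := (hgood _ (hreach n)).overField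
      haveI := (c n).ln
      exact Scheme.isNoetherian_of_finiteType_over_field g
    haveI := (c n).ln
    exact (c n).L.isClosed_part (hgood _ (hreach n)).isClosed_hsStratum (componentsIn.finite _) i
  -- the bad set at a state `r` between cycles: the image of the non-regular locus of the reduced treated part
  let cM : ℕ → MarkedStage.{u} := fun n => (c n).toMarkedStage
  let T : ∀ r, Set (c r).W := fun r =>
    (treatedPartIdeal N ν (cM r) (treatedLabel N ν (cM r)) (hclP r _)).subschemeι.base ''
      (Scheme.regularLocus (treatedPartIdeal N ν (cM r) (treatedLabel N ν (cM r)) (hclP r _)).subscheme)ᶜ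
  have hT : ∀ r, n₁ ≤ r → (c r).P = none → (c r).pt ∉ T r := by
    rintro r hr hP ⟨y, hy, hyx⟩
    exact hy (hn₁ r hr hP (hclP r _) y hyx)
  -- the replay invariant relative to a cycle start `r`, `d` steps later
  let Good : ℕ → ℕ → Prop := fun r d =>
    ∀ Q', (c (r + d)).P = some Q' → Q'.rest.CentresOver ((Q'.hom ≫ chainComp cM f r d).base ⁻¹' T r)
  -- a late state between cycles
  obtain ⟨m₀, hm₀n₁, hm₀⟩ := exists_next_none_hybrid (ω := ω) hπnone hstep n₁
  -- every stage `m ≥ m₀` lies in a (possibly aborted) cycle started at some `r ∈ [n₁, m]` along which the invariant holds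
  have main : ∀ m, m₀ ≤ m → ∃ r d, r + d = m ∧ n₁ ≤ r ∧ (c r).P = none ∧ Good r d := by
    intro m hm
    induction m, hm using Nat.le_induction with
    | base => exact ⟨m₀, 0, rfl, hm₀n₁, hm₀, fun Q' hQ' => (Option.some_ne_none Q' (hQ'.symm.trans hm₀)).elim⟩
    | succ m hm ih =>
      obtain ⟨r, d, hd, hr, hrP, hgood'⟩ := ih
      subst hd
      rcases hP : (c (r + d + 1)).P with _ | Q'
      · exact ⟨r + d + 1, 0, rfl, by omega, hP, fun Q'' hQ'' => (Option.some_ne_none Q'' (hQ''.symm.trans hP)).elim⟩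
      · rcases hPm : (c (r + d)).P with _ | Q
        · -- the step `r + d → r + d + 1` STARTS a cycle: fresh invariant relative to `r + d`
          refine ⟨r + d, 1, rfl, by omega, hPm, fun Q'' hQ'' => ?_⟩
          have hQQ : Q'' = Q' := Option.some_injective _ (hQ''.symm.trans hP)
          subst hQQ
          have := centresOver_of_none_hybrid hπnone hωsing (hf (r + d)) hPm (isLeast_treatedLabel_of_none (s := cM (r + d)) hPm (hne _))
            (hclP _ _) hQ''
          simpa [chainComp_succ, chainComp_zero] using this
        · -- a replay step inside the cycle started at `r`
          refine ⟨r, d + 1, rfl, hr, hrP, fun Q'' hQ'' => ?_⟩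
          have := centresOver_of_some_hybrid hπnone (hf (r + d)) hPm (chainComp cM f r d) (T r) (hgood' Q hPm) hQ''
          simpa [chainComp_succ] using this
  -- conclusion
  refine ⟨m₀, fun m hm hbu => ?_⟩
  by_contra hne'
  obtain ⟨r, d, hd, hr, hrP, hgood'⟩ := main m hm
  subst hd
  obtain ⟨C, P', hcs, hpt⟩ := hbu
  rcases hPm : (c (r + d)).P with _ | Q
  · -- cycle start that is not a cycle end
    have hsub := support_subset_image_of_none_hybrid hfun hπnone hωsing (hf (r + d)) hPm
      (isLeast_treatedLabel_of_none (s := cM (r + d)) hPm (hne _)) (hclP _ _) hne' hcs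
    exact hT (r + d) (by omega) hPm (hsub hpt)
  · -- replay step: the centre lies over `T r` through the replayed immersion and the blow-downs, which map `x_{r+d} ↦ x_r`
    have hsub := support_subset_image_of_some_hybrid hfun hπnone (hf (r + d)) hPm hne' (hgood' Q hPm) hcs
    obtain ⟨y, hy, hyx⟩ := hsub hpt
    apply hT r hr hrP
    have h1 : (chainComp cM f r d).base (Q.hom.base y) ∈ T r := by
      rw [Set.mem_preimage, Scheme.Hom.comp_apply] at hy
      exact hy
    have h2 : Q.hom.base y = (c (r + d)).pt := hyx
    rw [h2, chainComp_base_pt_σE hf r d] at h1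
    exact h1

/-- **E7's LOW CLASS AT A MAXIMAL ORIGIN FOR THE MENU HYBRID from (b), (c-reg), (c-menu) and the units half** — (c-rep) supplied by §3 (π, ω functional;
π emits `none`; ω names centres over the non-regular locus; the hybrid admissible on its run-wise scope). [cite: CossartJannsenSaito2020, Rem. 6.29 (1), Thm. 6.35, Thm. 6.40, p. 102, p. 107] -/
theorem low_init_hybrid_of_rows_cycleStartRegular (hK : LocalNearPointChainsTerminate.{u}) (hN0 : 0 < N) (hN3 : N ≤ 3)
    (hπ : π.IsFunctional N ν) (hω : OracleFunctionalΩE ω)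
    (hπnone : ∀ (W : Scheme.{u}) (hW : IsLocallyNoetherian W) (L : Labelling W) (P : Option (Pending W)) (E : Boundary W)
      (C : W.IdealSheafData) (P' : Option (Pending (blowup C))), π.step W hW N ν L P E C P' → P' = none)
    (hωsing : ∀ (W : Scheme.{u}) (hW : IsLocallyNoetherian W) (N : ℕ) (ν : ℕ → ℕ) (L : Labelling W) (E : Boundary W) (S : Scheme.{u})
      (φ : S ⟶ W) (t : CentreSeq S), ω.namesE W hW N ν L E S φ t → t.CentresOver (Scheme.regularLocus S)ᶜ)
    {p : ℕ} {E₀ : ∀ (X : Scheme.{u}), X → Boundary X}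
    (hadm : IsAdmissibleStrategyOnE (StrategyE.RunReachableState p (π.hybrid (StrategyE.ofStageOracleE ω)) N ν E₀) N ν
      (π.hybrid (StrategyE.ofStageOracleE ω)))
    {X : Scheme.{u}} [IsLocallyNoetherian X] {x : X} (hX : IsMaximalOrigin p N ν X x)
    (hbirths : StrataBirthsSettleFromσE (π.hybrid (StrategyE.ofStageOracleE ω)) N ν (MarkedStageE.init X x (E₀ X x))
      fun s => s.geomDirDim < N)
    (hreg : StrataCycleStartRegularFromσE (π.hybrid (StrategyE.ofStageOracleE ω)) N ν (MarkedStageE.init X x (E₀ X x))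
      fun s => s.geomDirDim < N)
    (hmenu : StrataPolicySwallowFromσE π (π.hybrid (StrategyE.ofStageOracleE ω)) N ν (MarkedStageE.init X x (E₀ X x))
      fun s => s.geomDirDim < N)
    (hunits : NoMovingRecurrentNearChainFromσE (π.hybrid (StrategyE.ofStageOracleE ω)) N ν (MarkedStageE.init X x (E₀ X x))
      (fun s => s.geomDirDim < N) fun s => Iso N s) :
    ∀ e, e < N → NoMovingNearChainFromσE (π.hybrid (StrategyE.ofStageOracleE ω)) N ν (MarkedStageE.init X x (E₀ X x))
      fun s => s.geomDirDim = e := by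
  obtain ⟨k, hk, h0⟩ := RunGood.init hX
  have hperm : ∀ (W : Scheme.{u}) (hW : IsLocallyNoetherian W) (L : Labelling W) (P : Option (Pending W)) (E : Boundary W),
      StrategyE.RunReachableState p (π.hybrid (StrategyE.ofStageOracleE ω)) N ν E₀ W hW L P E →
        ∀ (C : W.IdealSheafData) (P' : Option (Pending (blowup C))),
          (π.hybrid (StrategyE.ofStageOracleE ω)).step W hW N ν L P E C P' → IdealSheafData.IsPermissible C :=
    fun W hW L P E hS C P' hst => ((hadm W hW L P E hS).1 C P' hst).1
  have hgood : ∀ s : MarkedStageE.{u}, ReachesσE (π.hybrid (StrategyE.ofStageOracleE ω)) N ν (MarkedStageE.init X x (E₀ X x)) s →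
      RunGood k N ν s.W := fun s hs =>
    runGood_of_stateReachesσE (t := s.toStateσE) hX h0 hperm hs.stateReachesσE
  exact low_init_hybrid_of_rows hK hN0 hN3 hπ hω hadm hX hbirths
    (strataReplaySettleFromσE_hybrid_of_cycleStartRegular hπ hω hπnone hωsing hgood hX.mem_stratum hreg) hmenu hunits

end Summit.ResolutionOfSingularities.ResolutionOfSingularities.Theorems.SigmaMaxModificationsCorridor3.Sigma

end
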